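import Literature.Topology.FourManifolds.KnotOfClosedCurve
import Literature.Topology.FourManifolds.IsotopyExtension
import Mathlib.Algebra.Order.ToIntervalMod
import Mathlib.Analysis.SpecialFunctions.SmoothTransition
import HarnessLib

/-!
# Smooth families of regular simple closed curves give isotopic knots

Topic `Literature/Topology/FourManifolds` (trunk T-4MAN). Infrastructure for the fact seat
`provefact-Literature.Topology.FourManifolds.Knot.IsConnectedSum.isIsotopic` (Schubert's theorem;
the geometric heart `Knot.Schubert1949_normalPosition_rebuilt` of `SchubertNormalForm.lean` is to
be proved by a chain of *explicit one-parameter families of closed curves*, each of which is an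
isotopy of knots by the results of this file). Everything here is proved; no named facts are
introduced.

* § Periodisation (`Literature.Topology.FourManifolds.periodise a F = F ∘ toIcoMod 1 a`): a
  function `F : ℝ → X` which near the seam `a` satisfies `F (t + 1) = F t` periodises to a `C^∞`
  `1`-periodic function (`contDiff_periodise`), with local representations
  `periodise a F = F (· - n)` near every point (`periodise_eventuallyEq`); the same for smooth
  families `F u` (`contDiff_periodise_family`). This is the device by which
  `BandData.rebuildCurve` (`BandRebuildCurve.lean`) was built from its piece function, isolated.
* § Regular loops (`Literature.Topology.FourManifolds.IsRegularLoop c`): `C^∞`, `1`-periodic,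
  regular curves on the unit sphere `S³ ⊆ ℝ⁴`; rescaled to period `2π` they are regular closed
  curves (`KnotOfClosedCurve.lean`), and when injective modulo the period they define knots
  (`IsRegularLoop.toKnot`, `coe_toKnot_circlePt`).
* § Families: for a jointly `C^∞` family `Γ u` of regular closed curves the induced maps
  `𝕊¹ → 𝕊³` form a jointly smooth family (`IsRegularClosedCurve.contMDiff_toSphereMap_family` —
  the parameter is fed through the fibre slot of the tree's `periodicLift`), hence a **smooth
  isotopy of knots** when every stage is simple (`IsRegularClosedCurve.familyIsotopy`), hence —
  by the isotopy extension theorem proved in the tree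
  (`isAmbientIsotopic_of_isSmoothlyIsotopic_euclidean`, `IsotopyExtension.lean`; Hirsch (1976),
  Ch. 8 §1, Thm. 1.3) — the knots of the stages `u = 0` and `u = 1` are (ambient) **isotopic**
  (`IsRegularClosedCurve.isIsotopic_of_family`, with the variants `…_of_family_Icc` requiring
  the hypotheses only for `u ∈ [0, 1]`, and `IsRegularLoop.isIsotopic_of_family_Icc` for loops of
  period one).

## References

* M. W. Hirsch, *Differential Topology*, GTM 33 (1976), Ch. 8 §1, Thm. 1.3 (isotopy extension),
  Ch. 1 §3 (injective immersions of compact manifolds are embeddings). [HirschDT1976]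
* R. H. Crowell, R. H. Fox, *Introduction to Knot Theory* (1963), Ch. I §2 (differentiable knots
  as regular simple closed curves). [CrowellFox1963]
-/

open scoped Manifold ContDiff Topology Real
open Function Set Metric Filter

noncomputable section

namespace Literature.Topology.FourManifolds

/-- Local notation: `𝔼 n` is the model Euclidean space `EuclideanSpace ℝ (Fin n)`. -/
local notation "𝔼 " n:arg => EuclideanSpace ℝ (Fin n)

/-- Local notation: `𝕊 n` is the unit sphere in `EuclideanSpace ℝ (Fin (n + 1))`. -/
local notation "𝕊 " n:arg => (Metric.sphere (0 : EuclideanSpace ℝ (Fin (n + 1))) 1)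

/-- Local notation: the model with corners of `𝕊¹ × ℝ²`. -/
local notation "𝓘₁₂" => (ModelWithCorners.prod (𝓡 1) 𝓘(ℝ, EuclideanSpace ℝ (Fin 2)))

attribute [local instance] fact_finrank_euclideanSpace_two fact_finrank_euclideanSpace_four

/-! ## Periodisation along `toIcoMod` -/

section Periodise

variable {X : Type*} (a : ℝ) (F : ℝ → X)

/-- **Periodisation** of `F : ℝ → X` from the fundamental domain `[a, a + 1)`:
`periodise a F t = F (toIcoMod 1 a t)`. [folklore] -/
def periodise (t : ℝ) : X := F (toIcoMod zero_lt_one a t)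

/-- The reduced parameter lies in the fundamental domain. [folklore] -/
theorem toIcoMod_one_mem (t : ℝ) : toIcoMod zero_lt_one a t ∈ Ico a (a + 1) := toIcoMod_mem_Ico _ _ _

/-- On the window `[a + n, a + n + 1)` the reduction is `t ↦ t - n`. [folklore] -/
theorem toIcoMod_one_eq_sub {t : ℝ} {n : ℤ} (ht : t - n ∈ Ico a (a + 1)) : toIcoMod zero_lt_one a t = t - n := by
  rw [toIcoMod_eq_iff]
  exact ⟨ht, n, by simp⟩

/-- The reduced parameter differs from the parameter by an integer. [folklore] -/
theorem exists_toIcoMod_one_eq (t : ℝ) : ∃ n : ℤ, toIcoMod zero_lt_one a t = t - n := by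
  refine ⟨toIcoDiv zero_lt_one a t, ?_⟩
  have h := self_sub_toIcoDiv_zsmul zero_lt_one a t
  rw [zsmul_eq_mul, mul_one] at h
  exact h.symm

/-- The periodisation is `1`-periodic. [folklore] -/
theorem periodic_periodise : Periodic (periodise a F) 1 := fun t ↦ by
  simp only [periodise, toIcoMod_add_right]

/-- The periodisation is invariant under integer translations. [folklore] -/
theorem periodise_add_int (t : ℝ) (n : ℤ) : periodise a F (t + n) = periodise a F t := by
  simpa using (periodic_periodise a F).int_mul n t

/-- The periodisation is invariant under integer translations. [folklore] -/
theorem periodise_sub_int (t : ℝ) (n : ℤ) : periodise a F (t - n) = periodise a F t := by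
  simpa using (periodic_periodise a F).sub_int_mul_eq n (x := t)

/-- On the window `[a + n, a + n + 1)` the periodisation is `F (t - n)`. [folklore] -/
theorem periodise_eq_of_mem {t : ℝ} {n : ℤ} (ht : t - n ∈ Ico a (a + 1)) : periodise a F t = F (t - n) := by
  rw [periodise, toIcoMod_one_eq_sub a ht]

/-- On the fundamental domain the periodisation is `F`. [folklore] -/
theorem periodise_eq_self {t : ℝ} (ht : t ∈ Ico a (a + 1)) : periodise a F t = F t := by
  have h := periodise_eq_of_mem a F (n := 0) (t := t) (by simpa using ht)
  simpa using h

/-- Two parameters have the same reduction iff they differ by an integer. [folklore] -/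
theorem toIcoMod_one_eq_toIcoMod_one_iff {s t : ℝ} :
    toIcoMod zero_lt_one a s = toIcoMod zero_lt_one a t ↔ ∃ n : ℤ, t - s = n := by
  rw [toIcoMod_eq_toIcoMod zero_lt_one]
  simp

variable {a F}

/-- **Local representation of the periodisation.** If `F (t + 1) = F t` for `t` near the seam `a`,
then near every parameter `t₀` the periodisation is `F (· - n)` for one integer `n`. [folklore] -/
theorem periodise_eventuallyEq {ε : ℝ} (hε : 0 < ε) (hseam : ∀ t ∈ Ioo (a - ε) (a + ε), F (t + 1) = F t)
    (t₀ : ℝ) : ∃ n : ℤ, toIcoMod zero_lt_one a t₀ = t₀ - n ∧ periodise a F =ᶠ[𝓝 t₀] fun t ↦ F (t - n) := by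
  obtain ⟨n, hn⟩ := exists_toIcoMod_one_eq a t₀
  have hr := toIcoMod_one_mem a t₀
  rw [hn] at hr
  rcases hr.1.eq_or_lt with heq | hlt
  · -- the wrap point `t₀ = a + n`: use the seam condition on the left
    refine ⟨n, hn, ?_⟩
    have hε1 : min ε 1 ≤ 1 := min_le_right _ _
    have hε0 : 0 < min ε 1 := lt_min hε one_pos
    have hwin : Ioo (a + n - min ε 1) (a + n + min ε 1) ∈ 𝓝 t₀ :=
      isOpen_Ioo.mem_nhds ⟨by linarith, by linarith⟩
    filter_upwards [hwin] with t ht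
    rcases lt_or_ge (t - n) a with h | h
    · have hred : periodise a F t = F (t - (n - 1 : ℤ)) := periodise_eq_of_mem a F (by
        push_cast; exact ⟨by linarith [ht.1], by linarith⟩)
      rw [hred]
      push_cast
      rw [show t - (↑n - 1) = t - n + 1 by ring]
      exact hseam _ ⟨by linarith [ht.1, min_le_left ε 1], by linarith [min_le_left ε 1]⟩
    · exact periodise_eq_of_mem a F ⟨h, by linarith [ht.2]⟩
  · refine ⟨n, hn, ?_⟩
    have hwin : Ioo (a + n) (a + n + 1) ∈ 𝓝 t₀ := isOpen_Ioo.mem_nhds ⟨by linarith, by linarith [hr.2]⟩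
    filter_upwards [hwin] with t ht
    exact periodise_eq_of_mem a F ⟨by linarith [ht.1], by linarith [ht.2]⟩

/-- **Local representation of a periodised family**, uniformly in the family parameter: if
`F u (t + 1) = F u t` for all `u` and `t` near the seam, then near every `(u₀, t₀)` the periodised
family is `(u, t) ↦ F u (t - n)` for one integer `n`. [folklore] -/
theorem periodise_family_eventuallyEq {F : ℝ → ℝ → X} {ε : ℝ} (hε : 0 < ε)
    (hseam : ∀ u, ∀ t ∈ Ioo (a - ε) (a + ε), F u (t + 1) = F u t) (p₀ : ℝ × ℝ) :
    ∃ n : ℤ, toIcoMod zero_lt_one a p₀.2 = p₀.2 - n ∧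
      (fun p : ℝ × ℝ ↦ periodise a (F p.1) p.2) =ᶠ[𝓝 p₀] fun p ↦ F p.1 (p.2 - n) := by
  obtain ⟨n, hn⟩ := exists_toIcoMod_one_eq a p₀.2
  have hr := toIcoMod_one_mem a p₀.2
  rw [hn] at hr
  rcases hr.1.eq_or_lt with heq | hlt
  · refine ⟨n, hn, ?_⟩
    have hε0 : 0 < min ε 1 := lt_min hε one_pos
    have hwin : (univ : Set ℝ) ×ˢ Ioo (a + n - min ε 1) (a + n + min ε 1) ∈ 𝓝 p₀ :=
      prod_mem_nhds univ_mem (isOpen_Ioo.mem_nhds ⟨by linarith, by linarith⟩)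
    filter_upwards [hwin] with p hp
    obtain ⟨-, ht⟩ := hp
    rcases lt_or_ge (p.2 - n) a with h | h
    · have hred : periodise a (F p.1) p.2 = F p.1 (p.2 - (n - 1 : ℤ)) := periodise_eq_of_mem a (F p.1) (by
        push_cast; exact ⟨by linarith [ht.1, min_le_right ε 1], by linarith⟩)
      rw [hred]
      push_cast
      rw [show p.2 - (↑n - 1) = p.2 - n + 1 by ring]
      exact hseam _ _ ⟨by linarith [ht.1, min_le_left ε 1], by linarith [min_le_left ε 1]⟩
    · exact periodise_eq_of_mem a (F p.1) ⟨h, by linarith [ht.2, min_le_right ε 1]⟩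
  · refine ⟨n, hn, ?_⟩
    have hwin : (univ : Set ℝ) ×ˢ Ioo (a + n) (a + n + 1) ∈ 𝓝 p₀ :=
      prod_mem_nhds univ_mem (isOpen_Ioo.mem_nhds ⟨by linarith, by linarith [hr.2]⟩)
    filter_upwards [hwin] with p hp
    obtain ⟨-, ht⟩ := hp
    exact periodise_eq_of_mem a (F p.1) ⟨by linarith [ht.1], by linarith [ht.2]⟩

variable [NormedAddCommGroup X] [NormedSpace ℝ X]

/-- **The periodisation is `C^∞`** when `F` is and `F (t + 1) = F t` near the seam. [folklore] -/
theorem contDiff_periodise {ε : ℝ} (hF : ContDiff ℝ ∞ F) (hε : 0 < ε)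
    (hseam : ∀ t ∈ Ioo (a - ε) (a + ε), F (t + 1) = F t) : ContDiff ℝ ∞ (periodise a F) := by
  rw [contDiff_iff_contDiffAt]
  intro t₀
  obtain ⟨n, -, h⟩ := periodise_eventuallyEq hε hseam t₀
  exact (hF.comp (contDiff_id.sub contDiff_const)).contDiffAt.congr_of_eventuallyEq h

/-- **A periodised smooth family is jointly `C^∞`.** [folklore] -/
theorem contDiff_periodise_family {F : ℝ → ℝ → X} {ε : ℝ} (hF : ContDiff ℝ ∞ (uncurry F)) (hε : 0 < ε)
    (hseam : ∀ u, ∀ t ∈ Ioo (a - ε) (a + ε), F u (t + 1) = F u t) :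
    ContDiff ℝ ∞ fun p : ℝ × ℝ ↦ periodise a (F p.1) p.2 := by
  rw [contDiff_iff_contDiffAt]
  intro p₀
  obtain ⟨n, -, h⟩ := periodise_family_eventuallyEq hε hseam p₀
  have : ContDiff ℝ ∞ fun p : ℝ × ℝ ↦ F p.1 (p.2 - n) :=
    hF.comp (contDiff_fst.prodMk (contDiff_snd.sub contDiff_const))
  exact this.contDiffAt.congr_of_eventuallyEq h

/-- The value and the derivative of the periodisation at a parameter, through its reduction.
[folklore] -/
theorem deriv_periodise_eq {ε : ℝ} (hε : 0 < ε) (hseam : ∀ t ∈ Ioo (a - ε) (a + ε), F (t + 1) = F t)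
    (t₀ : ℝ) : ∃ n : ℤ, toIcoMod zero_lt_one a t₀ = t₀ - n ∧ periodise a F t₀ = F (t₀ - n) ∧
      deriv (periodise a F) t₀ = deriv F (t₀ - n) := by
  obtain ⟨n, hn, h⟩ := periodise_eventuallyEq hε hseam t₀
  refine ⟨n, hn, h.self_of_nhds, ?_⟩
  rw [h.deriv_eq]
  simpa using deriv_comp_sub_const (f := F) (a := (n : ℝ)) (x := t₀)

/-- On the fundamental domain the periodisation agrees with `F` to first order: same derivative
(at the seam `a` this uses the seam condition). [folklore] -/
theorem deriv_periodise_eq_of_mem {ε : ℝ} (hε : 0 < ε) (hseam : ∀ t ∈ Ioo (a - ε) (a + ε), F (t + 1) = F t)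
    {t₀ : ℝ} (ht₀ : t₀ ∈ Ico a (a + 1)) : deriv (periodise a F) t₀ = deriv F t₀ := by
  obtain ⟨n, hn, -, h⟩ := deriv_periodise_eq hε hseam t₀
  have h0 : toIcoMod zero_lt_one a t₀ = t₀ := (toIcoMod_eq_self zero_lt_one).2 ht₀
  have : (n : ℝ) = 0 := by linarith
  rw [h, this, sub_zero]

omit [NormedAddCommGroup X] [NormedSpace ℝ X] in
/-- **Modifying `F` away from the seam keeps the seam condition.** [folklore] -/
theorem seam_of_eqOn_compl {F' : ℝ → X} {ε : ℝ} {S : Set ℝ}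
    (hseam : ∀ t ∈ Ioo (a - ε) (a + ε), F (t + 1) = F t) (hS : S ⊆ Icc (a + ε) (a + 1 - ε))
    (heq : ∀ t, t ∉ S → F' t = F t) : ∀ t ∈ Ioo (a - ε) (a + ε), F' (t + 1) = F' t := by
  intro t ht
  have h1 : t ∉ S := fun h ↦ by have := (hS h).1; linarith [ht.2]
  have h2 : t + 1 ∉ S := fun h ↦ by have := (hS h).2; linarith [ht.1]
  rw [heq _ h1, heq _ h2, hseam t ht]

end Periodise

/-! ## Regular loops of period one -/

/-- A **regular loop on `S³` of period one**: a `C^∞`, `1`-periodic map `c : ℝ → ℝ⁴` with values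
on the unit sphere and nowhere vanishing velocity (the normalisation used by the piecewise
constructions of `BandRebuildCurve.lean`; period `2π` is `IsRegularClosedCurve`). [folklore] -/
structure IsRegularLoop (c : ℝ → 𝔼 4) : Prop where
  /-- The loop is `C^∞`. -/
  contDiff : ContDiff ℝ ∞ c
  /-- The loop is `1`-periodic. -/
  periodic : Periodic c 1
  /-- The loop lies on the unit sphere. -/
  norm_eq_one : ∀ t, ‖c t‖ = 1
  /-- The loop is regular. -/
  deriv_ne_zero : ∀ t, deriv c t ≠ 0

/-- The `2π`-periodic rescaling `θ ↦ c (θ / 2π)` of a loop of period one. [folklore] -/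
def loopRescale (c : ℝ → 𝔼 4) (θ : ℝ) : 𝔼 4 := c ((2 * π)⁻¹ * θ)

/-- Value of the rescaled loop. [folklore] -/
@[simp] theorem loopRescale_apply (c : ℝ → 𝔼 4) (θ : ℝ) : loopRescale c θ = c ((2 * π)⁻¹ * θ) := rfl

/-- The rescaled loop at `2π t` is `c t`. [folklore] -/
theorem loopRescale_two_pi_mul (c : ℝ → 𝔼 4) (t : ℝ) : loopRescale c (2 * π * t) = c t := by
  rw [loopRescale_apply, ← mul_assoc, inv_mul_cancel₀ (by positivity : (2 * π : ℝ) ≠ 0), one_mul]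

namespace IsRegularLoop

variable {c : ℝ → 𝔼 4} (h : IsRegularLoop c)
include h

/-- **A regular loop of period one rescales to a regular closed curve** (period `2π`). [folklore] -/
theorem isRegularClosedCurve : IsRegularClosedCurve (loopRescale c) where
  contDiff := h.contDiff.comp (contDiff_const.mul contDiff_id)
  periodic θ := by
    show c ((2 * π)⁻¹ * (θ + 2 * π)) = c ((2 * π)⁻¹ * θ)
    rw [mul_add, inv_mul_cancel₀ (by positivity), h.periodic]
  norm_eq_one θ := h.norm_eq_one _
  deriv_ne_zero θ := by
    show deriv (fun θ ↦ c ((2 * π)⁻¹ * θ)) θ ≠ 0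
    rw [deriv_comp_mul_left]
    exact smul_ne_zero (inv_ne_zero (by positivity)) (h.deriv_ne_zero _)

omit h in
/-- Injectivity modulo `1` of the loop gives injectivity modulo `2π` of the rescaled curve, in
the form consumed by `IsRegularClosedCurve.toKnot`. [folklore] -/
theorem circlePoint_eq_of_loopRescale_eq (hinj : ∀ s t, c s = c t → ∃ m : ℤ, t - s = m) (s t : ℝ)
    (hst : loopRescale c s = loopRescale c t) : circlePoint s = circlePoint t := by
  obtain ⟨m, hm⟩ := hinj _ _ hst
  have : t = s + m * (2 * π) := by
    have h := congrArg (fun x : ℝ ↦ 2 * π * x) hm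
    simp only [mul_sub, ← mul_assoc, mul_inv_cancel₀ (by positivity : (2 * π : ℝ) ≠ 0), one_mul] at h
    linarith
  rw [this]
  exact (periodic_circlePoint.int_mul m s).symm

/-- **The knot of a simple regular loop of period one** (`IsRegularClosedCurve.toKnot` of the
rescaled curve). [folklore] -/
def toKnot (hinj : ∀ s t, c s = c t → ∃ m : ℤ, t - s = m) : Knot :=
  h.isRegularClosedCurve.toKnot (circlePoint_eq_of_loopRescale_eq hinj)

/-- The knot of a loop through the parameter `circlePt t` is `c t` in `ℝ⁴`. [folklore] -/
theorem coe_toKnot_circlePt (hinj : ∀ s t, c s = c t → ∃ m : ℤ, t - s = m) (t : ℝ) :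
    ((h.toKnot hinj (circlePt t) : 𝕊 3) : 𝔼 4) = c t := by
  rw [toKnot, circlePt_eq_circlePoint, IsRegularClosedCurve.coe_toKnot_circlePoint, loopRescale_two_pi_mul]

/-- The knot of a loop through `circlePoint θ` is `c (θ / 2π)`. [folklore] -/
theorem coe_toKnot_circlePoint (hinj : ∀ s t, c s = c t → ∃ m : ℤ, t - s = m) (θ : ℝ) :
    ((h.toKnot hinj (circlePoint θ) : 𝕊 3) : 𝔼 4) = c ((2 * π)⁻¹ * θ) := by
  rw [toKnot, IsRegularClosedCurve.coe_toKnot_circlePoint, loopRescale_apply]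

/-- The range of the knot of a loop, read in `ℝ⁴`, is the range of the loop. [folklore] -/
theorem image_coe_range_toKnot (hinj : ∀ s t, c s = c t → ∃ m : ℤ, t - s = m) :
    (Subtype.val : (𝕊 3) → 𝔼 4) '' range (h.toKnot hinj) = range c := by
  rw [toKnot, IsRegularClosedCurve.image_coe_range_toKnot]
  ext p
  simp only [mem_range, loopRescale_apply]
  constructor
  · rintro ⟨θ, rfl⟩; exact ⟨_, rfl⟩
  · rintro ⟨t, rfl⟩
    exact ⟨2 * π * t, by rw [← mul_assoc, inv_mul_cancel₀ (by positivity : (2 * π : ℝ) ≠ 0), one_mul]⟩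

end IsRegularLoop

/-- Knots of equal curves are equal (the knot only depends on the curve, not on the proofs).
[folklore] -/
theorem IsRegularClosedCurve.toKnot_congr {γ γ' : ℝ → 𝔼 4} (h : IsRegularClosedCurve γ)
    (h' : IsRegularClosedCurve γ') (hinj : ∀ s t, γ s = γ t → circlePoint s = circlePoint t)
    (hinj' : ∀ s t, γ' s = γ' t → circlePoint s = circlePoint t) (e : γ = γ') :
    h.toKnot hinj = h'.toKnot hinj' := by
  subst e; rfl

/-- Knots of equal loops are equal. [folklore] -/
theorem IsRegularLoop.toKnot_congr {c c' : ℝ → 𝔼 4} (h : IsRegularLoop c) (h' : IsRegularLoop c')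
    (hinj : ∀ s t, c s = c t → ∃ m : ℤ, t - s = m) (hinj' : ∀ s t, c' s = c' t → ∃ m : ℤ, t - s = m)
    (e : c = c') : h.toKnot hinj = h'.toKnot hinj' := by
  subst e; rfl

/-! ## Loops from piece functions, and their modification away from the seam -/

section PieceLoops

variable {a ε : ℝ} {F F' : ℝ → 𝔼 4}

/-- **Simplicity of a periodisation**: the loop `periodise a F` identifies only parameters which
differ by integers iff `F` is injective on the fundamental domain `[a, a + 1)`. [folklore] -/
theorem periodise_simple_iff :
    (∀ s t, periodise a F s = periodise a F t → ∃ m : ℤ, t - s = m) ↔ InjOn F (Ico a (a + 1)) := by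
  constructor
  · intro h s hs t ht hst
    rw [← periodise_eq_self a F hs, ← periodise_eq_self a F ht] at hst
    obtain ⟨m, hm⟩ := h s t hst
    have h1 : (m : ℝ) < 1 := by rw [← hm]; linarith [hs.1, ht.2]
    have h2 : (-1 : ℝ) < m := by rw [← hm]; linarith [hs.2, ht.1]
    have hm0 : m = 0 := by
      have h1' : m < 1 := by exact_mod_cast h1
      have h2' : -1 < m := by exact_mod_cast h2
      omega
    rw [hm0] at hm
    simp only [Int.cast_zero] at hm
    linarith
  · intro h s t hst
    have := h (toIcoMod_one_mem a s) (toIcoMod_one_mem a t) hst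
    exact (toIcoMod_one_eq_toIcoMod_one_iff a).1 this

/-- **A periodisation is a regular loop** when `F` is `C^∞`, satisfies the seam condition, and is
unit and regular on the fundamental domain. [folklore] -/
theorem isRegularLoop_periodise (hF : ContDiff ℝ ∞ F) (hε : 0 < ε)
    (hseam : ∀ t ∈ Ioo (a - ε) (a + ε), F (t + 1) = F t) (hnorm : ∀ t ∈ Ico a (a + 1), ‖F t‖ = 1)
    (hderiv : ∀ t ∈ Ico a (a + 1), deriv F t ≠ 0) : IsRegularLoop (periodise a F) where
  contDiff := contDiff_periodise hF hε hseam
  periodic := periodic_periodise a F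
  norm_eq_one t := hnorm _ (toIcoMod_one_mem a t)
  deriv_ne_zero t := by
    obtain ⟨n, hn, -, h⟩ := deriv_periodise_eq hε hseam t
    rw [h]
    exact hderiv _ (hn ▸ toIcoMod_one_mem a t)

/-- The piece function of a regular loop is unit on the fundamental domain. [folklore] -/
theorem IsRegularLoop.norm_eq_one_of_mem (h : IsRegularLoop (periodise a F)) {t : ℝ}
    (ht : t ∈ Ico a (a + 1)) : ‖F t‖ = 1 := by
  rw [← periodise_eq_self a F ht]; exact h.norm_eq_one t

/-- The piece function of a regular loop is regular on the fundamental domain. [folklore] -/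
theorem IsRegularLoop.deriv_ne_zero_of_mem (h : IsRegularLoop (periodise a F)) (hε : 0 < ε)
    (hseam : ∀ t ∈ Ioo (a - ε) (a + ε), F (t + 1) = F t) {t : ℝ} (ht : t ∈ Ico a (a + 1)) :
    deriv F t ≠ 0 := by
  rw [← deriv_periodise_eq_of_mem hε hseam ht]; exact h.deriv_ne_zero t

/-- **Modification of a regular loop on a closed set away from the seam**: if `F'` is `C^∞`,
agrees with `F` off a closed `S ⊆ [a + ε, a + 1 - ε]`, and is unit and regular on `S`, then
`periodise a F'` is again a regular loop. [folklore] -/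
theorem IsRegularLoop.periodise_of_eqOn_compl {S : Set ℝ} (h : IsRegularLoop (periodise a F))
    (hF' : ContDiff ℝ ∞ F') (hε : 0 < ε) (hseam : ∀ t ∈ Ioo (a - ε) (a + ε), F (t + 1) = F t)
    (hS : S ⊆ Icc (a + ε) (a + 1 - ε)) (hSc : IsClosed S) (heq : ∀ t, t ∉ S → F' t = F t)
    (hnorm' : ∀ t ∈ S, ‖F' t‖ = 1) (hderiv' : ∀ t ∈ S, deriv F' t ≠ 0) :
    IsRegularLoop (periodise a F') := by
  refine isRegularLoop_periodise hF' hε (seam_of_eqOn_compl hseam hS heq) (fun t ht ↦ ?_) (fun t ht ↦ ?_)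
  · by_cases hts : t ∈ S
    · exact hnorm' t hts
    · rw [heq t hts]; exact h.norm_eq_one_of_mem ht
  · by_cases hts : t ∈ S
    · exact hderiv' t hts
    · have hev : F' =ᶠ[𝓝 t] F := by
        filter_upwards [hSc.isOpen_compl.mem_nhds hts] with s hs using heq s hs
      rw [hev.deriv_eq]
      exact h.deriv_ne_zero_of_mem hε hseam ht

/-- **Injectivity on the fundamental domain after a modification on `S`**: the new piece must be
injective on `S` and must avoid the old curve off `S`. [folklore] -/
theorem injOn_Ico_of_eqOn_compl {S : Set ℝ} (hinj : InjOn F (Ico a (a + 1)))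
    (heq : ∀ t, t ∉ S → F' t = F t) (hinj' : InjOn F' S)
    (hdisj : ∀ s ∈ S, ∀ t ∈ Ico a (a + 1), t ∉ S → F' s ≠ F t) : InjOn F' (Ico a (a + 1)) := by
  intro s hs t ht hst
  by_cases hsS : s ∈ S <;> by_cases htS : t ∈ S
  · exact hinj' hsS htS hst
  · exact absurd (hst.trans (heq t htS)) (hdisj s hsS t ht htS)
  · exact absurd (hst.symm.trans (heq s hsS)) (hdisj t htS s hs hsS)
  · rw [heq s hsS, heq t htS] at hst; exact hinj hs ht hst

/-- The window `[a + ε, a + 1 - ε]` lies in the fundamental domain. [folklore] -/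
theorem Icc_subset_Ico_fundamental (hε : 0 < ε) : Icc (a + ε) (a + 1 - ε) ⊆ Ico a (a + 1) :=
  fun _ ht ↦ ⟨by linarith [ht.1], by linarith [ht.2]⟩

end PieceLoops

/-! ## Smooth families of regular closed curves -/

namespace IsRegularClosedCurve

variable {Γ : ℝ → ℝ → 𝔼 4}

/-- The family read through the fibre slot of `periodicLift`: `(θ, w) ↦ Γ (w 0) θ`. [folklore] -/
def familyAux (Γ : ℝ → ℝ → 𝔼 4) (q : ℝ × 𝔼 2) : 𝔼 4 := Γ (q.2 0) q.1

omit Γ in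
/-- The auxiliary map is `C^∞` for a jointly `C^∞` family. [folklore] -/
theorem contDiff_familyAux {Γ : ℝ → ℝ → 𝔼 4} (hΓ : ContDiff ℝ ∞ (uncurry Γ)) : ContDiff ℝ ∞ (familyAux Γ) := by
  have h1 : ContDiff ℝ ∞ fun q : ℝ × 𝔼 2 ↦ (q.2 0, q.1) :=
    (((EuclideanSpace.proj (𝕜 := ℝ) (0 : Fin 2)).contDiff).comp contDiff_snd).prodMk contDiff_fst
  exact hΓ.comp h1

/-- **The induced maps `𝕊¹ → 𝕊³` of a jointly smooth family of regular closed curves form a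
jointly smooth family.** [folklore] -/
theorem contMDiff_toSphereMap_family (hΓ : ContDiff ℝ ∞ (uncurry Γ)) (h : ∀ u, IsRegularClosedCurve (Γ u)) :
    ContMDiff (𝓘(ℝ, ℝ).prod (𝓡 1)) (𝓡 3) ∞ fun p : ℝ × (𝕊 1) ↦ (h p.1).toSphereMap p.2 := by
  have hper : ∀ θ w, familyAux Γ (θ + 2 * π, w) = familyAux Γ (θ, w) := fun θ w ↦ (h (w 0)).periodic θ
  have h1 : ∀ q, ‖familyAux Γ q‖ = 1 := fun q ↦ (h (q.2 0)).norm_eq_one q.1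
  have hlift := contMDiff_periodicLift (contDiff_familyAux hΓ) hper h1
  have hι : ContMDiff (𝓘(ℝ, ℝ).prod (𝓡 1)) 𝓘₁₂ ∞
      fun p : ℝ × (𝕊 1) ↦ ((p.2, EuclideanSpace.single (0 : Fin 2) p.1) : (𝕊 1) × 𝔼 2) := by
    refine contMDiff_snd.prodMk ?_
    have hs : ContDiff ℝ ∞ fun u : ℝ ↦ EuclideanSpace.single (0 : Fin 2) u := by
      rw [contDiff_euclidean]
      intro i
      by_cases hi : i = 0
      · subst hi
        have : (fun u : ℝ ↦ (EuclideanSpace.single (0 : Fin 2) u) 0) = id := by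
          funext u; simp
        rw [this]; exact contDiff_id
      · have : (fun u : ℝ ↦ (EuclideanSpace.single (0 : Fin 2) u) i) = fun _ ↦ 0 := by
          funext u; simp [hi]
        rw [this]; exact contDiff_const
    exact hs.contMDiff.comp contMDiff_fst
  have heq : (fun p : ℝ × (𝕊 1) ↦ (h p.1).toSphereMap p.2) =
      fun p ↦ periodicLift (familyAux Γ) h1 (p.2, EuclideanSpace.single (0 : Fin 2) p.1) := by
    funext p
    apply Subtype.ext
    rw [coe_periodicLift]
    obtain ⟨θ, hθ⟩ := circlePoint_surjective p.2
    rw [← hθ, coe_toSphereMap_circlePoint]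
    simp only [familyAux, PiLp.single_apply, if_true]
    have hp : periodicLift (h p.1).tube (h p.1).norm_tube (circlePoint θ, 0) = (h p.1).toSphereMap (circlePoint θ) := rfl
    have := congrArg (Subtype.val : (𝕊 3) → 𝔼 4) hp
    rw [coe_periodicLift, (h p.1).tube_zero, coe_toSphereMap_circlePoint] at this
    exact this.symm
  rw [heq]
  exact hlift.comp hι

/-- **The smooth isotopy of knots defined by a smooth family of regular simple closed curves.**
[folklore] -/
def familyIsotopy (hΓ : ContDiff ℝ ∞ (uncurry Γ)) (h : ∀ u, IsRegularClosedCurve (Γ u))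
    (hinj : ∀ u s t, Γ u s = Γ u t → circlePoint s = circlePoint t) :
    SmoothIsotopy (𝓡 1) (𝓡 3) ⇑((h 0).toKnot (hinj 0)) ⇑((h 1).toKnot (hinj 1)) where
  toFun u := (h u).toSphereMap
  contMDiff := contMDiff_toSphereMap_family hΓ h
  isSmoothEmbedding u := (h u).isSmoothEmbedding_toSphereMap (hinj u)
  map_zero := rfl
  map_one := rfl

/-- **Knots of a smooth family of regular simple closed curves are isotopic**: the family is a
smooth isotopy of embeddings `𝕊¹ → 𝕊³`, which the isotopy extension theorem (Hirsch (1976),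
Ch. 8 §1, Thm. 1.3; proved in the tree, `IsotopyExtension.lean`) covers by an ambient isotopy.
[cite: HirschDT1976, Ch. 8 §1, Thm. 1.3] -/
theorem isIsotopic_of_family (hΓ : ContDiff ℝ ∞ (uncurry Γ)) (h : ∀ u, IsRegularClosedCurve (Γ u))
    (hinj : ∀ u s t, Γ u s = Γ u t → circlePoint s = circlePoint t) :
    ((h 0).toKnot (hinj 0)).IsIsotopic ((h 1).toKnot (hinj 1)) :=
  isAmbientIsotopic_of_isSmoothlyIsotopic_euclidean _ _ ⟨familyIsotopy hΓ h hinj⟩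

/-- The clamp `u ↦ smoothTransition u` of the family parameter into `[0, 1]`. [folklore] -/
theorem smoothTransition_mem_Icc (u : ℝ) : Real.smoothTransition u ∈ Icc (0 : ℝ) 1 :=
  ⟨Real.smoothTransition.nonneg u, Real.smoothTransition.le_one u⟩

/-- **Knots of a smooth family of curves which are regular simple closed curves for
`u ∈ [0, 1]` are isotopic** (clamp the parameter by `Real.smoothTransition`). [cite: HirschDT1976, Ch. 8 §1, Thm. 1.3] -/
theorem isIsotopic_of_family_Icc (hΓ : ContDiff ℝ ∞ (uncurry Γ))
    (h : ∀ u ∈ Icc (0 : ℝ) 1, IsRegularClosedCurve (Γ u))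
    (hinj : ∀ u ∈ Icc (0 : ℝ) 1, ∀ s t, Γ u s = Γ u t → circlePoint s = circlePoint t) :
    ((h 0 ⟨le_rfl, zero_le_one⟩).toKnot (hinj 0 ⟨le_rfl, zero_le_one⟩)).IsIsotopic
      ((h 1 ⟨zero_le_one, le_rfl⟩).toKnot (hinj 1 ⟨zero_le_one, le_rfl⟩)) := by
  set Γ' : ℝ → ℝ → 𝔼 4 := fun u ↦ Γ (Real.smoothTransition u) with hΓ'
  have hΓ'c : ContDiff ℝ ∞ (uncurry Γ') :=
    hΓ.comp ((Real.smoothTransition.contDiff.comp contDiff_fst).prodMk contDiff_snd)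
  have h' : ∀ u, IsRegularClosedCurve (Γ' u) := fun u ↦ h _ (smoothTransition_mem_Icc u)
  have hinj' : ∀ u s t, Γ' u s = Γ' u t → circlePoint s = circlePoint t :=
    fun u ↦ hinj _ (smoothTransition_mem_Icc u)
  have hiso := isIsotopic_of_family hΓ'c h' hinj'
  have e0 : Γ' 0 = Γ 0 := by simp [hΓ', Real.smoothTransition.zero]
  have e1 : Γ' 1 = Γ 1 := by simp [hΓ', Real.smoothTransition.one]
  rwa [toKnot_congr (h' 0) (h 0 ⟨le_rfl, zero_le_one⟩) (hinj' 0) (hinj 0 ⟨le_rfl, zero_le_one⟩) e0,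
    toKnot_congr (h' 1) (h 1 ⟨zero_le_one, le_rfl⟩) (hinj' 1) (hinj 1 ⟨zero_le_one, le_rfl⟩) e1] at hiso

end IsRegularClosedCurve

/-! ## Smooth families of regular loops of period one -/

namespace IsRegularLoop

variable {C : ℝ → ℝ → 𝔼 4}

/-- **Knots of a smooth family of loops which are simple regular loops for `u ∈ [0, 1]` are
isotopic.** [cite: HirschDT1976, Ch. 8 §1, Thm. 1.3] -/
theorem isIsotopic_of_family_Icc (hC : ContDiff ℝ ∞ (uncurry C))
    (h : ∀ u ∈ Icc (0 : ℝ) 1, IsRegularLoop (C u))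
    (hinj : ∀ u ∈ Icc (0 : ℝ) 1, ∀ s t, C u s = C u t → ∃ m : ℤ, t - s = m) :
    ((h 0 ⟨le_rfl, zero_le_one⟩).toKnot (hinj 0 ⟨le_rfl, zero_le_one⟩)).IsIsotopic
      ((h 1 ⟨zero_le_one, le_rfl⟩).toKnot (hinj 1 ⟨zero_le_one, le_rfl⟩)) := by
  have hΓ : ContDiff ℝ ∞ (uncurry fun u ↦ loopRescale (C u)) :=
    hC.comp (contDiff_fst.prodMk ((contDiff_const.mul contDiff_id).comp contDiff_snd))
  exact IsRegularClosedCurve.isIsotopic_of_family_Icc hΓ (fun u hu ↦ (h u hu).isRegularClosedCurve)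
    fun u hu ↦ circlePoint_eq_of_loopRescale_eq (hinj u hu)

/-- **Knots of two simple regular loops joined by a smooth family of simple regular loops are
isotopic** (the form with the end curves prescribed). [cite: HirschDT1976, Ch. 8 §1, Thm. 1.3] -/
theorem isIsotopic_of_family_eq {c₀ c₁ : ℝ → 𝔼 4} (h₀ : IsRegularLoop c₀) (h₁ : IsRegularLoop c₁)
    (hinj₀ : ∀ s t, c₀ s = c₀ t → ∃ m : ℤ, t - s = m) (hinj₁ : ∀ s t, c₁ s = c₁ t → ∃ m : ℤ, t - s = m)
    (hC : ContDiff ℝ ∞ (uncurry C)) (h : ∀ u ∈ Icc (0 : ℝ) 1, IsRegularLoop (C u))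
    (hinj : ∀ u ∈ Icc (0 : ℝ) 1, ∀ s t, C u s = C u t → ∃ m : ℤ, t - s = m)
    (e₀ : C 0 = c₀) (e₁ : C 1 = c₁) : (h₀.toKnot hinj₀).IsIsotopic (h₁.toKnot hinj₁) := by
  have hiso := isIsotopic_of_family_Icc hC h hinj
  rwa [toKnot_congr _ h₀ _ hinj₀ e₀, toKnot_congr _ h₁ _ hinj₁ e₁] at hiso

/-- **Isotopy of knots along a smooth family of modifications of a loop on a closed set away from
the seam.** Let `periodise a F` be a simple regular loop and `G u` a jointly `C^∞` family of
piece functions agreeing with `F` off a closed `S ⊆ [a + ε, a + 1 - ε]` and at `u = 0`, unit,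
regular and injective on `S` and avoiding the old curve off `S` for `u ∈ [0, 1]`. Then the knots
of `periodise a F` and `periodise a (G 1)` are isotopic. [cite: HirschDT1976, Ch. 8 §1, Thm. 1.3] -/
theorem isIsotopic_of_modification {a ε : ℝ} {F : ℝ → 𝔼 4} {G : ℝ → ℝ → 𝔼 4} {S : Set ℝ}
    (h₀ : IsRegularLoop (periodise a F)) (hinj₀ : InjOn F (Ico a (a + 1)))
    (h₁ : IsRegularLoop (periodise a (G 1))) (hinj₁ : InjOn (G 1) (Ico a (a + 1)))
    (hε : 0 < ε) (hseam : ∀ t ∈ Ioo (a - ε) (a + ε), F (t + 1) = F t)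
    (hG : ContDiff ℝ ∞ (uncurry G)) (hS : S ⊆ Icc (a + ε) (a + 1 - ε)) (hSc : IsClosed S)
    (heq : ∀ u t, t ∉ S → G u t = F t) (h0 : ∀ t, G 0 t = F t)
    (hnorm : ∀ u ∈ Icc (0 : ℝ) 1, ∀ t ∈ S, ‖G u t‖ = 1)
    (hderiv : ∀ u ∈ Icc (0 : ℝ) 1, ∀ t ∈ S, deriv (G u) t ≠ 0)
    (hinjS : ∀ u ∈ Icc (0 : ℝ) 1, InjOn (G u) S)
    (hdisj : ∀ u ∈ Icc (0 : ℝ) 1, ∀ s ∈ S, ∀ t ∈ Ico a (a + 1), t ∉ S → G u s ≠ F t) :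
    (h₀.toKnot (periodise_simple_iff.2 hinj₀)).IsIsotopic (h₁.toKnot (periodise_simple_iff.2 hinj₁)) := by
  have hGu : ∀ u, ContDiff ℝ ∞ (G u) := fun u ↦ hG.comp (contDiff_const.prodMk contDiff_id)
  have hseam' : ∀ u, ∀ t ∈ Ioo (a - ε) (a + ε), G u (t + 1) = G u t :=
    fun u ↦ seam_of_eqOn_compl hseam hS (heq u)
  refine isIsotopic_of_family_eq (C := fun u ↦ periodise a (G u)) h₀ h₁ _ _
    (contDiff_periodise_family hG hε hseam') (fun u hu ↦ ?_) (fun u hu ↦ ?_) ?_ rfl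
  · exact h₀.periodise_of_eqOn_compl (hGu u) hε hseam hS hSc (heq u) (hnorm u hu) (hderiv u hu)
  · exact periodise_simple_iff.2 (injOn_Ico_of_eqOn_compl hinj₀ (heq u) (hinjS u hu) (hdisj u hu))
  · funext t
    simp only [periodise, h0]

end IsRegularLoop

end Literature.Topology.FourManifolds
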